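import Summits.Ventures.PercRepro.RankLevelSetUpFive

/-! # RankLevelSetUpFiveRankFiveSort — THE SORTS OF `T_5` AND `V_6` ALONG A PARALLEL CLASS OF A RANK-`5` DUAL, THE
SMALL FAMILIES AND `g_4 ≤ ḡ_5` (night-1 g40; dossier §52.14; on `RankLevelSetUpFive`)

For `N = M✶` loopless of rank `5` a bi-spanning `5`-set is a basis, so it meets a parallel class `P = cl {p}` in
at most one element (**`not_two_parallel_of_spanning_five_rank_five`**), and a bi-spanning `6`-set in at most two
(**`not_three_parallel_of_spanning_six_rank_five`**). The piece bijections of `RankLevelSetUpPieces` give the sorts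
`T_5 = A_5 + q · g_4` (**`through_five_eq_rank_five`**, `q ≥ 2`), `V_6 = Ā_6 + q · ḡ_5 + C(q,2) · ḡ_4`
(**`avoid_six_eq_rank_five_of_three_le`**) and `V_6 = Ā_6 + 2 · ḡ_5 + ḡ_4^{sp}` (**`avoid_six_eq_rank_five_of_two`**).
Cutting the class to two elements and using (↑)₅ of the cut matroid (the inductive hypothesis; the exact middle
when `#E' = 9`) with `g_4 ≤ ḡ_5` — (↑)₄ of the rank-`4` contraction, i.e. `upAt_four_of_nullity_le_four` on the
nullity-`4` deletion `M ＼ P` (**`throughHat_four_le_avoidHat_five_rank_five`**, `#E' ≥ 10`) — closes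
`T_5(N) = T_5(N'') + (q − 2) g_4 ≤ V_6(N'') + (q − 2) g_4 ≤ Ā_6 + 2 ḡ_5 + ḡ_4 + (q − 2) ḡ_5 ≤ V_6(N)`; for `#E' ≤ 8`
the families are small (**`upFull_five_eq_empty_rank_five`**, **`throughHat_four_eq_empty_rank_five`**) and
`C(q,2) ≥ q` suffices. The theorems themselves are in `RankLevelSetUpFiveRankFive`. Every declaration has a
docstring; imports: the cell's own modules and Mathlib only. Axioms: standard. -/

namespace PercRepro

open Set Matroid

variable {α : Type}

/-! ## Parallel elements in spanning sets of a rank-`5` matroid -/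

/-- **A spanning `5`-set of a rank-`5` matroid contains no two distinct parallel elements**: deleting one of them
would leave a spanning `4`-set. -/
lemma not_two_parallel_of_spanning_five_rank_five {N : Matroid α} [N.Finite] (hnl : ∀ e ∈ N.E, N.IsNonloop e)
    (hr : N.eRank = 5) {W : Set α} (hW : N.Spanning W) (hW5 : W.ncard = 5) {p x y : α} (hx : x ∈ W) (hy : y ∈ W)
    (hxy : x ≠ y) (hxP : x ∈ N.closure {p}) (hyP : y ∈ N.closure {p}) : False := by
  have hWfin : W.Finite := N.ground_finite.subset hW.subset_ground
  have hxnl : N.IsNonloop x := hnl x (hW.subset_ground hx)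
  have hclx : N.closure {x} = N.closure {p} := hxnl.closure_eq_of_mem_closure hxP
  have hy' : y ∈ N.closure (W \ {y}) := by
    have : y ∈ N.closure {x} := by rw [hclx]; exact hyP
    have hxW' : x ∈ W \ {y} := ⟨hx, fun h => hxy (by simpa using h)⟩
    exact N.closure_subset_closure (Set.singleton_subset_iff.mpr hxW') this
  have hsp : N.Spanning (W \ {y}) := (spanning_sdiff_singleton_iff hW hy).mpr hy'
  have h1 := eRank_le_encard_of_spanning hsp
  rw [hr, (hWfin.subset Set.sdiff_subset).encard_eq_coe_toFinset_card,
    ← Set.ncard_eq_toFinset_card _ (hWfin.subset Set.sdiff_subset), Set.ncard_sdiff_singleton_of_mem hy,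
    hW5] at h1
  norm_num at h1

/-- **A spanning `6`-set of a rank-`5` matroid contains no three distinct parallel elements**: deleting one of them
leaves a spanning `5`-set with two. -/
lemma not_three_parallel_of_spanning_six_rank_five {N : Matroid α} [N.Finite] (hnl : ∀ e ∈ N.E, N.IsNonloop e)
    (hr : N.eRank = 5) {Z : Set α} (hZ : N.Spanning Z) (hZ6 : Z.ncard = 6) {p x y z : α} (hx : x ∈ Z) (hy : y ∈ Z)
    (hz : z ∈ Z) (hxy : x ≠ y) (hxz : x ≠ z) (hyz : y ≠ z) (hxP : x ∈ N.closure {p}) (hyP : y ∈ N.closure {p})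
    (hzP : z ∈ N.closure {p}) : False := by
  have hxnl : N.IsNonloop x := hnl x (hZ.subset_ground hx)
  have hclx : N.closure {x} = N.closure {p} := hxnl.closure_eq_of_mem_closure hxP
  have hz' : z ∈ N.closure (Z \ {z}) := by
    have : z ∈ N.closure {x} := by rw [hclx]; exact hzP
    have hxZ' : x ∈ Z \ {z} := ⟨hx, fun h => hxz (by simpa using h)⟩
    exact N.closure_subset_closure (Set.singleton_subset_iff.mpr hxZ') this
  have hsp : N.Spanning (Z \ {z}) := (spanning_sdiff_singleton_iff hZ hz).mpr hz'
  have h5 : (Z \ {z}).ncard = 5 := by rw [Set.ncard_sdiff_singleton_of_mem hz, hZ6]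
  exact not_two_parallel_of_spanning_five_rank_five hnl hr hsp h5 (p := p) ⟨hx, fun h => hxz (by simpa using h)⟩
    ⟨hy, fun h => hyz (by simpa using h)⟩ hxy hxP hyP

variable (N : Matroid α) [N.Finite]

/-! ## The sorts at rank `5` -/

/-- **`T_5` is the sum of its pieces `s = 0, 1`** (`rk N = 5`). -/
theorem through_five_sum_rank_five (hnl : ∀ e ∈ N.E, N.IsNonloop e) (hr : N.eRank = 5) (p b : α) :
    {W ∈ biSpan N 5 | b ∈ W}.ncard = (pieceThrough N p b 5 0).ncard + (pieceThrough N p b 5 1).ncard := by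
  classical
  set T := {W ∈ biSpan N 5 | b ∈ W} with hT
  have hTfin : T.Finite := N.ground_finite.finite_subsets.subset (fun _ h => h.1.1)
  have hsub : ∀ s, pieceThrough N p b 5 s ⊆ T := fun s _ h => ⟨h.1, h.2.1⟩
  have hdisj : Disjoint (pieceThrough N p b 5 0) (pieceThrough N p b 5 1) := by
    rw [Set.disjoint_left]; rintro W ⟨-, -, hs⟩ ⟨-, -, ht⟩; omega
  have hcover : T = pieceThrough N p b 5 0 ∪ pieceThrough N p b 5 1 := by
    ext W
    simp only [Set.mem_union, pieceThrough, Set.mem_setOf_eq]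
    constructor
    · intro hW
      have hW' := hW
      obtain ⟨⟨hWE, hW5, hWs, -⟩, hbW⟩ := hW'
      have hWfin : W.Finite := N.ground_finite.subset hWE
      have hle : (W ∩ N.closure {p}).ncard ≤ 1 := by
        by_contra hgt
        have hgt' : 1 < (W ∩ N.closure {p}).ncard := by omega
        rw [Set.one_lt_ncard_iff (hWfin.subset Set.inter_subset_left)] at hgt'
        obtain ⟨x, y, hx, hy, hxy⟩ := hgt'
        exact not_two_parallel_of_spanning_five_rank_five hnl hr hWs hW5 (p := p) hx.1 hy.1 hxy hx.2 hy.2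
      rcases Nat.lt_or_ge (W ∩ N.closure {p}).ncard 1 with h0 | h1
      · exact Or.inl ⟨hW.1, hbW, by omega⟩
      · exact Or.inr ⟨hW.1, hbW, by omega⟩
    · rintro (h | h) <;> exact ⟨h.1, h.2.1⟩
  rw [hcover, Set.ncard_union_eq hdisj (hTfin.subset (hsub 0)) (hTfin.subset (hsub 1))]

/-- **`V_6` is the sum of its pieces `s = 0, 1, 2`** (`rk N = 5`). -/
theorem avoid_six_sum_rank_five (hnl : ∀ e ∈ N.E, N.IsNonloop e) (hr : N.eRank = 5) (p b : α) :
    {Z ∈ biSpan N 6 | b ∉ Z}.ncard =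
      (pieceAvoid N p b 6 0).ncard + (pieceAvoid N p b 6 1).ncard + (pieceAvoid N p b 6 2).ncard := by
  classical
  set V := {Z ∈ biSpan N 6 | b ∉ Z} with hV
  have hVfin : V.Finite := N.ground_finite.finite_subsets.subset (fun _ h => h.1.1)
  have hsub : ∀ s, pieceAvoid N p b 6 s ⊆ V := fun s _ h => ⟨h.1, h.2.1⟩
  have hdisj : ∀ s t, s ≠ t → Disjoint (pieceAvoid N p b 6 s) (pieceAvoid N p b 6 t) := by
    intro s t hst; rw [Set.disjoint_left]; rintro Z ⟨-, -, hs⟩ ⟨-, -, ht⟩; exact hst (hs.symm.trans ht)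
  have hcover : V = pieceAvoid N p b 6 0 ∪ pieceAvoid N p b 6 1 ∪ pieceAvoid N p b 6 2 := by
    ext Z
    simp only [Set.mem_union, pieceAvoid, Set.mem_setOf_eq]
    constructor
    · intro hZ
      have hZ' := hZ
      obtain ⟨⟨hZE, hZ6, hZs, -⟩, hbZ⟩ := hZ'
      have hZfin : Z.Finite := N.ground_finite.subset hZE
      have hle : (Z ∩ N.closure {p}).ncard ≤ 2 := by
        by_contra hgt
        have hgt' : 2 < (Z ∩ N.closure {p}).ncard := by omega
        rw [Set.two_lt_ncard (hZfin.subset Set.inter_subset_left)] at hgt'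
        obtain ⟨x, hx, y, hy, z, hz, hxy, hxz, hyz⟩ := hgt'
        exact not_three_parallel_of_spanning_six_rank_five hnl hr hZs hZ6 (p := p) hx.1 hy.1 hz.1 hxy hxz hyz
          hx.2 hy.2 hz.2
      rcases Nat.lt_or_ge (Z ∩ N.closure {p}).ncard 1 with h0 | h1
      · exact Or.inl (Or.inl ⟨hZ.1, hbZ, by omega⟩)
      · rcases Nat.lt_or_ge (Z ∩ N.closure {p}).ncard 2 with h1' | h2
        · exact Or.inl (Or.inr ⟨hZ.1, hbZ, by omega⟩)
        · exact Or.inr ⟨hZ.1, hbZ, by omega⟩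
    · rintro ((h | h) | h) <;> exact ⟨h.1, h.2.1⟩
  rw [hcover, Set.ncard_union_eq ?_ ((hVfin.subset (hsub 0)).union (hVfin.subset (hsub 1))) (hVfin.subset (hsub 2)),
    Set.ncard_union_eq (hdisj 0 1 (by norm_num)) (hVfin.subset (hsub 0)) (hVfin.subset (hsub 1))]
  exact Set.disjoint_union_left.mpr ⟨hdisj 0 2 (by norm_num), hdisj 1 2 (by norm_num)⟩

/-- **`T_5 = A_5 + q · g_4` for `q ≥ 2`** (`rk N = 5`). -/
theorem through_five_eq_rank_five (hnl : ∀ e ∈ N.E, N.IsNonloop e) (hr : N.eRank = 5) {p : α} (hp : p ∈ N.E)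
    (hq : 2 ≤ (N.closure {p}).ncard) {b : α} (hbP : b ∉ N.closure {p}) :
    {W ∈ biSpan N 5 | b ∈ W}.ncard = (upFull N p b 5).ncard +
      (N.closure {p}).ncard * (throughHat N p b 4).ncard := by
  rw [through_five_sum_rank_five N hnl hr p b, pieceThrough_zero N hnl hp b 5,
    pieceThrough_ncard N hnl hp hbP (k := 5) (s := 1) le_rfl (by omega) (by norm_num), Nat.choose_one_right]

/-- **`V_6 = Ā_6 + q · ḡ_5 + C(q,2) · ḡ_4` for `q ≥ 3`** (`rk N = 5`). -/
theorem avoid_six_eq_rank_five_of_three_le (hnl : ∀ e ∈ N.E, N.IsNonloop e) (hr : N.eRank = 5) {p : α}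
    (hp : p ∈ N.E) (hq : 3 ≤ (N.closure {p}).ncard) {b : α} (hbP : b ∉ N.closure {p}) :
    {Z ∈ biSpan N 6 | b ∉ Z}.ncard = (avoidFull N p b 6).ncard +
      (N.closure {p}).ncard * (avoidHat N p b 5).ncard +
      (N.closure {p}).ncard.choose 2 * (avoidHat N p b 4).ncard := by
  rw [avoid_six_sum_rank_five N hnl hr p b, pieceAvoid_zero N hnl hp b 6,
    pieceAvoid_ncard N hnl hp hbP (k := 6) (s := 1) le_rfl (by omega) (by norm_num),
    pieceAvoid_ncard N hnl hp hbP (k := 6) (s := 2) (by norm_num) (by omega) (by norm_num),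
    Nat.choose_one_right]

/-- **`V_6 = Ā_6 + 2 · ḡ_5 + ḡ_4^{sp}` for `q = 2`** (`rk N = 5`). -/
theorem avoid_six_eq_rank_five_of_two (hnl : ∀ e ∈ N.E, N.IsNonloop e) (hr : N.eRank = 5) {p : α}
    (hp : p ∈ N.E) (hq : (N.closure {p}).ncard = 2) {b : α} (hbP : b ∉ N.closure {p}) :
    {Z ∈ biSpan N 6 | b ∉ Z}.ncard = (avoidFull N p b 6).ncard + 2 * (avoidHat N p b 5).ncard +
      (avoidSp N p b 4).ncard := by
  rw [avoid_six_sum_rank_five N hnl hr p b, pieceAvoid_zero N hnl hp b 6,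
    pieceAvoid_ncard N hnl hp hbP (k := 6) (s := 1) le_rfl (by omega) (by norm_num), Nat.choose_one_right, hq]
  have h := pieceAvoid_top_ncard N hnl hp hbP (k := 6) (by omega)
  rw [hq] at h
  rw [h]

/-! ## The small families at rank `5` -/

/-- **`A_5` is empty when `#(E ∖ cl {p}) ≤ 8`** (`rk N = 5`): the complement of a member, together with `p`, has at
most four elements. -/
lemma upFull_five_eq_empty_rank_five (hr : N.eRank = 5) {p b : α} (h8 : (N.E \ N.closure {p}).ncard ≤ 8) :
    upFull N p b 5 = ∅ := by
  set E' := N.E \ N.closure {p} with hE'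
  have hE'fin : E'.Finite := N.ground_finite.subset Set.sdiff_subset
  rw [Set.eq_empty_iff_forall_notMem]
  rintro W ⟨hWE, hW5, -, -, hWc⟩
  have h1 := eRank_le_encard_of_spanning hWc
  have hfin : (insert p (E' \ W)).Finite := (hE'fin.subset Set.sdiff_subset).insert p
  rw [hr, hfin.encard_eq_coe_toFinset_card, ← Set.ncard_eq_toFinset_card _ hfin] at h1
  have h2 : (insert p (E' \ W)).ncard ≤ (E' \ W).ncard + 1 := Set.ncard_insert_le p _
  have h3 : (E' \ W).ncard = E'.ncard - 5 := by rw [Set.ncard_sdiff hWE (hE'fin.subset hWE), hW5]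
  have h4 : (5 : ℕ) ≤ (insert p (E' \ W)).ncard := by exact_mod_cast h1
  omega

/-- **`g_4` is empty when `#(E ∖ cl {p}) ≤ 7`** (`rk N = 5`). -/
lemma throughHat_four_eq_empty_rank_five (hr : N.eRank = 5) {p b : α} (h7 : (N.E \ N.closure {p}).ncard ≤ 7) :
    throughHat N p b 4 = ∅ := by
  set E' := N.E \ N.closure {p} with hE'
  have hE'fin : E'.Finite := N.ground_finite.subset Set.sdiff_subset
  rw [Set.eq_empty_iff_forall_notMem]
  rintro U ⟨hUE, hU4, -, -, hUc⟩
  have h1 := eRank_le_encard_of_spanning hUc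
  have hfin : (insert p (E' \ U)).Finite := (hE'fin.subset Set.sdiff_subset).insert p
  rw [hr, hfin.encard_eq_coe_toFinset_card, ← Set.ncard_eq_toFinset_card _ hfin] at h1
  have h2 : (insert p (E' \ U)).ncard ≤ (E' \ U).ncard + 1 := Set.ncard_insert_le p _
  have h3 : (E' \ U).ncard = E'.ncard - 4 := by rw [Set.ncard_sdiff hUE (hE'fin.subset hUE), hU4]
  have h4 : (5 : ℕ) ≤ (insert p (E' \ U)).ncard := by exact_mod_cast h1
  omega

/-! ## `g_4 ≤ ḡ_5` from (↑)₄ of the rank-`4` contraction -/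

variable (M : Matroid α) [M.Finite]

/-- **`g_4 ≤ ḡ_5` when `#(E ∖ cl✶ {p}) ≥ 10`** (`M` coloop-free of nullity `5`): (↑) at level `4` of the nullity-`4`
deletion `M ＼ cl✶ {p}` (`upAt_four_of_nullity_le_four`). -/
lemma throughHat_four_le_avoidHat_five_rank_five (hcol : ∀ e, ¬ M.IsColoop e) (hν : M✶.eRank = 5) {p : α}
    (hp : p ∈ M.E) {b : α} (hb : b ∈ M.E) (hbP : b ∉ M✶.closure {p})
    (h10 : 10 ≤ (M.E \ M✶.closure {p}).ncard) :
    (throughHat M✶ p b 4).ncard ≤ (avoidHat M✶ p b 5).ncard := by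
  rw [throughHat_eq_biIndep_delete M hcol hp, avoidHat_eq_biIndep_delete M hcol hp]
  have hpnl : M✶.IsNonloop p := dual_isNonloop_of_coloopFree M hcol hp
  have hr : (M.delete (M✶.closure {p}))✶.eRank ≤ 4 := by
    have := eRank_dual_delete_seriesClass_add_one_le M hpnl
    rw [hν] at this
    have h4 : (4 : ℕ∞) + 1 = 5 := by norm_num
    rw [← h4] at this
    exact (WithTop.add_le_add_iff_right (by decide)).mp this
  have hbE : b ∈ (M.delete (M✶.closure {p})).E := ⟨hb, hbP⟩
  have hn : 10 ≤ (M.delete (M✶.closure {p})).E.ncard := by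
    rw [Matroid.delete_ground]; exact h10
  exact upAt_four_of_nullity_le_four (M.delete (M✶.closure {p})) hr hn hbE

end PercRepro
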